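import Summits.Ventures.CertifiedManyBodySolver.Theorems.M3x2EdgeSplitSymReplaySyntaxV

/-!
# SymReplay checker — certificate TEXT DECODER (additive data-path plumbing, hub-lb-sym-eng-4 g1)

A `SymCert` (T1 `…Theorems.M3x2EdgeSplitSymReplaySyntax`) shipped as Lean term syntax costs the ELABORATOR one
numeral/constructor unification per token (a 25 KB literal `def` exceeds the default 200 000 heartbeats; measured on the
lb-sym rung `w3d2⊕box2d3`, 0.38 MB ⇒ farm rc 1).  This module lets certificate modules ship their data as `String`
literals of whitespace-separated decimal integers (elaboration cost: one string literal) and DECODE them at evaluation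
time (`native_decide` / `#eval`, compiled): `decodeSymCert (toks s) : SymCert`.  Soundness is untouched — every theorem
about the decoded certificate goes through `symCheck` (via `symCheckV_eq`) exactly as for a term literal; a malformed
string can only make the checker return `false`.  Token grammar (all integers; counts prefix their lists):
`frame: n (x y)ⁿ · inner: n (x y)ⁿ · mu: p q · c: p q · useCanon: 0|1 · gramM: n block ⁿ · eom: n polyⁿ · wardP: n polyⁿ ·
wardM: n polyⁿ · antiH: n (p q poly)ⁿ · slack: n (p q word)ⁿ · charged: n (p q word)ⁿ`, with `block: p q nB polyⁿᴮ nR rowⁿᴿ`,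
`row: n (ℓ k)ⁿ`, `poly: n (p q word)ⁿ`, `word: n (x y s dag)ⁿ`.  All recursions are structural (fuel = the count just read).
No summit statement is proved here; nothing here predicts superconductivity.
-/

namespace Summit.Ventures.CertifiedManyBodySolver.Theorems.SymReplay

open Literature.Probability.LatticeModels (Site)

section Decode

/-- Token stream: the integers of a data string. -/
abbrev Toks := List ℤ

/-- Tokeniser state: finished tokens (reversed), current magnitude, sign flag, inside-a-token flag. -/
structure TokSt where
  acc : List ℤ
  cur : ℕ
  neg : Bool
  inTok : Bool

/-- One character of the tokeniser: digits extend the current token, `-` marks it negative, anything else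
(blank, newline) closes it. -/
def tokStep (st : TokSt) (ch : Char) : TokSt :=
  if ch.isDigit then { st with cur := st.cur * 10 + (ch.toNat - 48), inTok := true }
  else if ch == '-' then { st with neg := true }
  else if st.inTok then ⟨(if st.neg then -(st.cur : ℤ) else (st.cur : ℤ)) :: st.acc, 0, false, false⟩
  else { st with neg := false }

/-- Tokenise a data string: the decimal integers it contains, in order (single left fold, no intermediate list). -/
def toks (s : String) : Toks := ((tokStep (s.foldl tokStep ⟨[], 0, false, false⟩) ' ').acc).reverse

/-- Concatenate the token streams of several data strings (chunk modules). -/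
def toksOf (l : List String) : Toks := l.flatMap toks

/-- Read a count (non-negative integer; junk `0` on an empty stream). -/
def rdNat : Toks → ℕ × Toks
  | n :: ts => (n.toNat, ts)
  | [] => (0, [])

/-- Read a rational `p q ↦ p / q`. -/
def rdQ : Toks → ℚ × Toks
  | p :: q :: ts => ((p : ℚ) / (q : ℚ), ts)
  | _ => (0, [])

/-- Read `n` sites `(x y)`. -/
def rdSites : ℕ → Toks → List (Site 2) × Toks
  | 0, ts => ([], ts)
  | n + 1, x :: y :: ts => let r := rdSites n ts; (mkSite x y :: r.1, r.2)
  | _ + 1, _ => ([], [])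

/-- Read `n` letters `(x y s dag)`. -/
def rdLetters : ℕ → Toks → Word × Toks
  | 0, ts => ([], ts)
  | n + 1, x :: y :: s :: d :: ts =>
    let r := rdLetters n ts
    (⟨mkSite x y, if s == 1 then 1 else 0, d == 1⟩ :: r.1, r.2)
  | _ + 1, _ => ([], [])

/-- Read a word `n (x y s dag)ⁿ`. -/
def rdWord (ts : Toks) : Word × Toks := let c := rdNat ts; rdLetters c.1 c.2

/-- Read `n` terms `(p q word)`. -/
def rdTerms : ℕ → Toks → QPoly × Toks
  | 0, ts => ([], ts)
  | n + 1, ts =>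
    let q := rdQ ts
    let w := rdWord q.2
    let r := rdTerms n w.2
    ((q.1, w.1) :: r.1, r.2)

/-- Read a polynomial `n (p q word)ⁿ`. -/
def rdPoly (ts : Toks) : QPoly × Toks := let c := rdNat ts; rdTerms c.1 c.2

/-- Read `n` polynomials. -/
def rdPolys : ℕ → Toks → List QPoly × Toks
  | 0, ts => ([], ts)
  | n + 1, ts => let p := rdPoly ts; let r := rdPolys n p.2; (p.1 :: r.1, r.2)

/-- Read `n` row entries `(ℓ k)`. -/
def rdEntries : ℕ → Toks → List (ℚ × ℕ) × Toks
  | 0, ts => ([], ts)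
  | n + 1, l :: k :: ts => let r := rdEntries n ts; (((l : ℚ), k.toNat) :: r.1, r.2)
  | _ + 1, _ => ([], [])

/-- Read `n` rows `m (ℓ k)ᵐ`. -/
def rdRows : ℕ → Toks → List (List (ℚ × ℕ)) × Toks
  | 0, ts => ([], ts)
  | n + 1, ts => let c := rdNat ts; let e := rdEntries c.1 c.2; let r := rdRows n e.2; (e.1 :: r.1, r.2)

/-- Read a Gram block `p q nB polyⁿᴮ nR rowⁿᴿ`. -/
def rdBlock (ts : Toks) : GramBlock × Toks :=
  let s := rdQ ts
  let cb := rdNat s.2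
  let b := rdPolys cb.1 cb.2
  let cr := rdNat b.2
  let r := rdRows cr.1 cr.2
  (⟨s.1, b.1, r.1⟩, r.2)

/-- Read `n` Gram blocks. -/
def rdBlocks : ℕ → Toks → List GramBlock × Toks
  | 0, ts => ([], ts)
  | n + 1, ts => let b := rdBlock ts; let r := rdBlocks n b.2; (b.1 :: r.1, r.2)

/-- Read `n` weighted polynomials `(p q poly)`. -/
def rdQPolys : ℕ → Toks → List (ℚ × QPoly) × Toks
  | 0, ts => ([], ts)
  | n + 1, ts => let q := rdQ ts; let p := rdPoly q.2; let r := rdQPolys n p.2; ((q.1, p.1) :: r.1, r.2)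

/-- Read `n` weighted words `(p q word)` (= `rdTerms`). -/
def rdQWords (n : ℕ) (ts : Toks) : List (ℚ × Word) × Toks := rdTerms n ts

/-- **Decode a whole certificate** (grammar in the module docstring; `moves := []`, `gram := []`). -/
def decodeSymCert (ts : Toks) : SymCert :=
  let f := rdNat ts;        let frame := rdSites f.1 f.2
  let i := rdNat frame.2;   let inner := rdSites i.1 i.2
  let mu := rdQ inner.2
  let c := rdQ mu.2
  let uc := rdNat c.2
  let g := rdNat uc.2;      let gramM := rdBlocks g.1 g.2
  let e := rdNat gramM.2;   let eom := rdPolys e.1 e.2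
  let wp := rdNat eom.2;    let wardP := rdPolys wp.1 wp.2
  let wm := rdNat wardP.2;  let wardM := rdPolys wm.1 wm.2
  let ah := rdNat wardM.2;  let antiH := rdQPolys ah.1 ah.2
  let sl := rdNat antiH.2;  let slack := rdQWords sl.1 sl.2
  let ch := rdNat slack.2;  let charged := rdQWords ch.1 ch.2
  { frame := frame.1, inner := inner.1, mu := mu.1, c := c.1, gram := [], gramM := gramM.1, eom := eom.1, moves := [],
    charged := charged.1, wardP := wardP.1, wardM := wardM.1, antiH := antiH.1, slack := slack.1, useCanon := uc.1 == 1 }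

/-- Number of tokens left over after decoding (a well-formed data string leaves `0`). -/
def decodeRest (ts : Toks) : ℕ :=
  let f := rdNat ts;        let frame := rdSites f.1 f.2
  let i := rdNat frame.2;   let inner := rdSites i.1 i.2
  let mu := rdQ inner.2
  let c := rdQ mu.2
  let uc := rdNat c.2
  let g := rdNat uc.2;      let gramM := rdBlocks g.1 g.2
  let e := rdNat gramM.2;   let eom := rdPolys e.1 e.2
  let wp := rdNat eom.2;    let wardP := rdPolys wp.1 wp.2
  let wm := rdNat wardP.2;  let wardM := rdPolys wm.1 wm.2
  let ah := rdNat wardM.2;  let antiH := rdQPolys ah.1 ah.2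
  let sl := rdNat antiH.2;  let slack := rdQWords sl.1 sl.2
  let ch := rdNat slack.2;  let charged := rdQWords ch.1 ch.2
  charged.2.length

/-- Demo (compiled evaluation): the tokeniser reads signed integers across blanks and newlines. -/
example : toks "2  1 1 2 0 0\n0 1 0 0 0 0  -3 40 1 1 0 1 1" = [2, 1, 1, 2, 0, 0, 0, 1, 0, 0, 0, 0, -3, 40, 1, 1, 0, 1, 1] := by
  native_decide

/-- Demo (compiled evaluation): a 2-term polynomial decodes to `c†_{0,0,↑} c_{0,0,↑} − (3/40) c†_{(1,0),↓}` — checked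
through the checker's own syntactic zero test (`isZero ∘ psub`). -/
example : isZero (psub (rdPoly (toks "2  1 1 2 0 0 0 1 0 0 0 0  -3 40 1 1 0 1 1")).1
    [((1 : ℚ), [cre (mkSite 0 0) 0, ann (mkSite 0 0) 0]), (((-3 : ℚ) / 40), [cre (mkSite 1 0) 1])]) = true := by
  native_decide

end Decode

end Summit.Ventures.CertifiedManyBodySolver.Theorems.SymReplay
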